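/-
Copyright: H21 programme, solo seat `solo-RiemannHypothesis-informed` (session 4).
-/
import Summits.RiemannHypothesis.RiemannHypothesis.Theorems.SoloInformedLocalSampling
import Summits.RiemannHypothesis.RiemannHypothesis.Theorems.SoloInformedDensityConst

/-!
# Effective sampling chain, I (solo-informed, T23)

T9a, T11a, T11 restated with the DEFINITE density constant `zetaDensityConst` (T21) in place of
the existential `A₁`; the proofs are those of `SoloInformedZeroSide` / `SoloInformedLocalSampling`
verbatim, reading the density bound from `density_le_zetaDensityConst`. Combined with T22
(`zetaDensityConst ≤ 27000` under the named fact `zetaZeroCount_hasanalizade_shen_wong`) every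
constant below is an absolute number.
-/

open MeasureTheory Complex Set Filter Topology Literature.NumberTheory.LFunctions
open scoped ContDiff ComplexConjugate

namespace Summit.RiemannHypothesis.RiemannHypothesis.Theorems

/-- **T9a, effective.** For every weight `F` with `F ρ ≤ M/(1+(Im ρ − γ₀)²)` on the closed strip
(`M ≥ 0`) and every `T`: `∑_{ρ ∈ weilZeroIndex T} m(ρ)F(ρ) ≤ 2·zetaDensityConst·M·log(|γ₀|+2)`. -/
theorem finsum_weilZeroIndex_le_of_kernel_bound_eff :
    ∀ (F : ℂ → ℝ) (M γ₀ : ℝ), 0 ≤ M →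
      (∀ ρ : ℂ, 0 ≤ ρ.re → ρ.re ≤ 1 → F ρ ≤ M / (1 + (ρ.im - γ₀) ^ 2)) →
      ∀ T : ℝ, ∑ᶠ ρ ∈ weilZeroIndex T, (riemannZetaZeroOrder ρ : ℝ) * F ρ
        ≤ 2 * zetaDensityConst * M * Real.log (|γ₀| + 2) := by
  intro F M γ₀ hM hF T
  have hD := fun t : ℝ ↦ density_le_zetaDensityConst t
  set A₁ : ℝ := zetaDensityConst
  have _hA₁ : 0 < A₁ := zetaDensityConst_pos
  have hfin := zetaZeroBox_finite 0 T
  have hfin' : ((starRingEnd ℂ) '' zetaZeroBox 0 T).Finite := hfin.image _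
  rw [weilZeroIndex_eq_union, finsum_mem_union (disjoint_zetaZeroBox_conj T) hfin hfin']
  have hconj : ∀ ρ : ℂ, riemannZetaZeroOrder ((starRingEnd ℂ) ρ) = riemannZetaZeroOrder ρ :=
    riemannZetaZeroOrder_conj_holds
  -- the box `0 < Im ρ ≤ T`
  have h1 : ∑ᶠ ρ ∈ zetaZeroBox 0 T, (riemannZetaZeroOrder ρ : ℝ) * F ρ
      ≤ M * (A₁ * Real.log (|γ₀| + 2)) := by
    have hG : ∀ ρ ∈ zetaZeroBox 0 T, F ρ ≤ M / (1 + (ρ.im - γ₀) ^ 2) :=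
      fun ρ hρ ↦ hF ρ hρ.2.1 hρ.2.2.1
    exact (finsum_zetaZeroBox_le_of_kernel_bound T hM hG (hD γ₀).1).trans
      (mul_le_mul_of_nonneg_left (hD γ₀).2 hM)
  -- the conjugate box `−T ≤ Im ρ < 0`, via `m(ρ̄) = m(ρ)` and the kernel centred at `−γ₀`
  have h2 : ∑ᶠ ρ ∈ (starRingEnd ℂ) '' zetaZeroBox 0 T, (riemannZetaZeroOrder ρ : ℝ) * F ρ
      ≤ M * (A₁ * Real.log (|γ₀| + 2)) := by
    rw [finsum_mem_image fun x _ y _ h ↦ (starRingEnd ℂ).injective h]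
    simp_rw [hconj]
    have hG : ∀ ρ ∈ zetaZeroBox 0 T, F ((starRingEnd ℂ) ρ) ≤ M / (1 + (ρ.im - -γ₀) ^ 2) := by
      intro ρ hρ
      have h := hF ((starRingEnd ℂ) ρ) (by simpa using hρ.2.1) (by simpa using hρ.2.2.1)
      rw [Complex.conj_im, show (-ρ.im - γ₀) ^ 2 = (ρ.im - -γ₀) ^ 2 by ring] at h
      exact h
    have h := finsum_zetaZeroBox_le_of_kernel_bound (G := fun ρ ↦ F ((starRingEnd ℂ) ρ)) T hM
      hG (hD (-γ₀)).1
    refine h.trans ?_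
    have h' := mul_le_mul_of_nonneg_left (hD (-γ₀)).2 hM
    rwa [abs_neg] at h'
  calc ∑ᶠ ρ ∈ zetaZeroBox 0 T, (riemannZetaZeroOrder ρ : ℝ) * F ρ
        + ∑ᶠ ρ ∈ (starRingEnd ℂ) '' zetaZeroBox 0 T, (riemannZetaZeroOrder ρ : ℝ) * F ρ
      ≤ M * (A₁ * Real.log (|γ₀| + 2)) + M * (A₁ * Real.log (|γ₀| + 2)) := add_le_add h1 h2
    _ = 2 * A₁ * M * Real.log (|γ₀| + 2) := by ring

/-- **T11a, effective.** The same with a finite exceptional set `S` of points `≠ 1` where the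
majorant is not assumed: `∑ m(ρ)F(ρ) ≤ 2·zetaDensityConst·M·log(|γ₀|+2) + ∑_{ρ∈S} m(ρ)F(ρ)`. -/
theorem finsum_weilZeroIndex_le_of_kernel_bound_off_eff :
    ∀ (F : ℂ → ℝ) (M γ₀ : ℝ) (S : Finset ℂ), 0 ≤ M → (∀ ρ, 0 ≤ F ρ) →
      (∀ ρ ∈ S, ρ ≠ 1) →
      (∀ ρ : ℂ, 0 ≤ ρ.re → ρ.re ≤ 1 → ρ ∉ S → F ρ ≤ M / (1 + (ρ.im - γ₀) ^ 2)) →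
      ∀ T : ℝ, ∑ᶠ ρ ∈ weilZeroIndex T, (riemannZetaZeroOrder ρ : ℝ) * F ρ
        ≤ 2 * zetaDensityConst * M * Real.log (|γ₀| + 2)
          + ∑ ρ ∈ S, (riemannZetaZeroOrder ρ : ℝ) * F ρ := by
  intro F M γ₀ S hM hF hS1 hmaj T
  have hK := finsum_weilZeroIndex_le_of_kernel_bound_eff
  set A₁ : ℝ := zetaDensityConst
  have _hA₁ : 0 < A₁ := zetaDensityConst_pos
  classical
  set F' : ℂ → ℝ := fun ρ ↦ if ρ ∈ S then 0 else F ρ with hF'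
  have hK' := hK F' M γ₀ hM (fun ρ h0 h1 ↦ by
    by_cases hρ : ρ ∈ S
    · simp only [hF', hρ, if_true]; positivity
    · simp only [hF', hρ, if_false]; exact hmaj ρ h0 h1 hρ) T
  have hfin := weilZeroIndex_finite T
  rw [finsum_mem_eq_finite_toFinset_sum _ hfin] at hK' ⊢
  have hsplit : ∀ ρ, (riemannZetaZeroOrder ρ : ℝ) * F ρ =
      (riemannZetaZeroOrder ρ : ℝ) * F' ρ +
        (if ρ ∈ S then (riemannZetaZeroOrder ρ : ℝ) * F ρ else 0) := by
    intro ρ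
    by_cases hρ : ρ ∈ S
    · simp only [hF', hρ, if_true, mul_zero, zero_add]
    · simp only [hF', hρ, if_false, add_zero]
  rw [Finset.sum_congr rfl fun ρ _ ↦ hsplit ρ, Finset.sum_add_distrib]
  have hle : ∑ ρ ∈ hfin.toFinset, (if ρ ∈ S then (riemannZetaZeroOrder ρ : ℝ) * F ρ else 0)
      ≤ ∑ ρ ∈ S, (riemannZetaZeroOrder ρ : ℝ) * F ρ := by
    rw [← Finset.sum_filter]
    refine Finset.sum_le_sum_of_subset_of_nonneg (fun ρ hρ ↦ (Finset.mem_filter.mp hρ).2)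
      fun ρ hρS _ ↦ ?_
    exact mul_nonneg (by exact_mod_cast riemannZetaZeroOrder_nonneg (hS1 ρ hρS)) (hF ρ)
  linarith

/-- **T11, effective.** The local sampling-energy bound with `A₁ = zetaDensityConst`. -/
theorem weilSamplingEnergy_le_local_eff :
    ∀ (h : ℝ → ℂ) (a γ₀ R : ℝ) (n : ℕ) (S : Finset ℂ), IsWeilTest h →
      0 ≤ a → 1 ≤ R → tsupport h ⊆ Icc (-a) a → (∀ ρ ∈ S, ρ ≠ 1) →
      (∀ ρ : ℂ, riemannZeta ρ = 0 → 0 ≤ ρ.re → ρ.re ≤ 1 → |ρ.im - γ₀| < R → ρ ∉ S →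
          ρ.re = 1 / 2) →
      ∀ T : ℝ,
        ∑ᶠ ρ ∈ weilZeroIndex T, (riemannZetaZeroOrder ρ : ℝ) *
            ‖weilMellin (fun t ↦ h t * cexp (-(γ₀ * I) * t)) ρ‖ ^ 2
          ≤ 2 * zetaDensityConst * (((∫ t : ℝ, ‖h t‖) ^ 2 + (∫ t : ℝ, ‖deriv h t‖) ^ 2)
                + 2 * Real.exp a * (∫ t : ℝ, ‖iteratedDeriv (n + 1) h t‖) ^ 2 / R ^ (2 * n))
              * Real.log (|γ₀| + 2)
            + ∑ ρ ∈ S, (riemannZetaZeroOrder ρ : ℝ) *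
                ‖weilMellin (fun t ↦ h t * cexp (-(γ₀ * I) * t)) ρ‖ ^ 2 := by
  intro h a γ₀ R n S hh ha hR hhs hS1 hloc T
  have hK := finsum_weilZeroIndex_le_of_kernel_bound_off_eff
  set A₁ : ℝ := zetaDensityConst
  have _hA₁ : 0 < A₁ := zetaDensityConst_pos
  classical
  set g : ℝ → ℂ := fun t ↦ h t * cexp (-(γ₀ * I) * t) with hg
  set Mn : ℝ := (∫ t : ℝ, ‖h t‖) ^ 2 + (∫ t : ℝ, ‖deriv h t‖) ^ 2 with hMn
  set Mf : ℝ := 2 * Real.exp a * (∫ t : ℝ, ‖iteratedDeriv (n + 1) h t‖) ^ 2 / R ^ (2 * n)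
    with hMf
  have hR0 : 0 < R := by linarith
  have hMn0 : 0 ≤ Mn := by positivity
  have hMf0 : 0 ≤ Mf := by positivity
  set F : ℂ → ℝ := fun ρ ↦ if riemannZeta ρ = 0 then ‖weilMellin g ρ‖ ^ 2 else 0 with hF
  have hF0 : ∀ ρ, 0 ≤ F ρ := fun ρ ↦ by
    by_cases hz : riemannZeta ρ = 0
    · simp only [hF, hz, if_true]; positivity
    · simp only [hF, hz, if_false]; exact le_rfl
  have hFle : ∀ ρ, F ρ ≤ ‖weilMellin g ρ‖ ^ 2 := fun ρ ↦ by
    by_cases hz : riemannZeta ρ = 0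
    · simp only [hF, hz, if_true]; exact le_rfl
    · simp only [hF, hz, if_false]; positivity
  have hmaj : ∀ ρ : ℂ, 0 ≤ ρ.re → ρ.re ≤ 1 → ρ ∉ S →
      F ρ ≤ (Mn + Mf) / (1 + (ρ.im - γ₀) ^ 2) := by
    intro ρ h0 h1 hρS
    have hden : 0 < 1 + (ρ.im - γ₀) ^ 2 := by positivity
    by_cases hz : riemannZeta ρ = 0
    · have hFρ : F ρ = ‖weilMellin g ρ‖ ^ 2 := by simp only [hF, hz, if_true]
      rw [hFρ]
      by_cases hnear : |ρ.im - γ₀| < R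
      · have hre := hloc ρ hz h0 h1 hnear hρS
        calc ‖weilMellin g ρ‖ ^ 2 ≤ Mn / (1 + (ρ.im - γ₀) ^ 2) :=
              norm_sq_weilMellin_twist_le_kernel_critical hh hhs γ₀ hre
          _ ≤ (Mn + Mf) / (1 + (ρ.im - γ₀) ^ 2) := by gcongr; linarith
      · have hfar : R ≤ |ρ.im - γ₀| := not_lt.mp hnear
        calc ‖weilMellin g ρ‖ ^ 2 ≤ Mf / (1 + (ρ.im - γ₀) ^ 2) :=
              norm_sq_weilMellin_twist_le_kernel_far hh ha hhs γ₀ n hR h0 h1 hfar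
          _ ≤ (Mn + Mf) / (1 + (ρ.im - γ₀) ^ 2) := by gcongr; linarith
    · simp only [hF, hz, if_false]; positivity
  have hK' := hK F (Mn + Mf) γ₀ S (by positivity) hF0 hS1 hmaj T
  have hcongr : ∑ᶠ ρ ∈ weilZeroIndex T, (riemannZetaZeroOrder ρ : ℝ) * F ρ =
      ∑ᶠ ρ ∈ weilZeroIndex T, (riemannZetaZeroOrder ρ : ℝ) * ‖weilMellin g ρ‖ ^ 2 :=
    finsum_mem_congr rfl fun ρ hρ ↦ by
      have hz : riemannZeta ρ = 0 := hρ.1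
      simp only [hF, hz, if_true]
  rw [← hcongr]
  refine hK'.trans (add_le_add le_rfl (Finset.sum_le_sum fun ρ hρ ↦ ?_))
  exact mul_le_mul_of_nonneg_left (hFle ρ)
    (by exact_mod_cast riemannZetaZeroOrder_nonneg (hS1 ρ hρ))

end Summit.RiemannHypothesis.RiemannHypothesis.Theorems
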